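import Summits.BirchSwinnertonDyer.Rank1Residual.ManinAdditive.ShimuraKernel
import Summits.BirchSwinnertonDyer.BirchSwinnertonDyer.Theses.ManinLocalTwoThree
import Summits.BirchSwinnertonDyer.Rank1Residual.ManinAdditive.KatoCurvePlusDefect
import Summits.BirchSwinnertonDyer.Rank1Residual.ManinConstantOne
import Summits.BirchSwinnertonDyer.BirchSwinnertonDyer.Theorems.ManinLocalTwoThreeThirdLatticeVelu
import Mathlib.Algebra.Module.ZLattice.Covolume
import HarnessLib

/-!
# Manin's conjecture at `2` and at `3` from STEVENS' two conjectures (1989), the Shimura-index exclusions and F-need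

Summit `BirchSwinnertonDyer`, route `ManinLocalTwoThree` (cell bsd-f2-manin), cruxes C2 `ManinOddAtFour` (stmt-BirchSwinnertonDyer-22967) and
C3 `ManinPrimeToThreeAtNine` (stmt-BirchSwinnertonDyer-22968); lead p1 gen 14.  The two printed conjectures of G. Stevens, *Stickelberger
elements and modular parametrizations of elliptic curves*, Invent. Math. 98 (1989): Conjecture I/III «the `X₁(N)`-optimal curve has
Manin constant `±1`» (tree `ManinConstant.StevensConstantOne`) and Conjecture II «the `X₁(N)`-optimal curve is the curve of MINIMAL FALTINGS
HEIGHT of its class» (Thm. 2.3 there: ⟺ maximal Néron covolume; tree predicate `KatoCurve.IsMaxCovolumeInClass`, es g17), read on the tree's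
Γ₀/Γ₁ ledger:

* `index_four_of_maxCovolume_of_natAbs_eq_two_mul` — **at `4 ∣ N`, if the Stevens curve `E₁` has maximal covolume, DOUBLING `|c₀| = 2|c₁|`
  forces the index-`4` configuration `Λ₁(f) = 2Λ₀(f)`**: doubling puts `Λ_{E₀} ⊆ Λ_{E₁}` (Ling–Oesterlé), a sub-lattice of index
  `covol(Λ_{E₀})/covol(Λ_{E₁}) ≤ 1` (`ZLattice.covolume_div_covolume_eq_relIndex'`), so `Λ_{E₁} = Λ_{E₀}`, i.e. `c₁Λ₁ = 2c₁Λ₀`;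
  `index_nine_of_maxCovolume_of_natAbs_eq_three_mul` — the same at `9 ∣ N` with tripling and index `9`;
* `gammaOneTransferAtFour_of_maxCovolume` — **Stevens II (for Stevens data at `4 ∣ N`) ∧ E-an-152b `ShimuraIndexNeFourAtFour` ⟹ E-an-151**
  (`|c₀| = |c₁|`);
* `maninOddAtFourBody_of_stevensConjectures` / `maninOddAtFour_of_stevensConjectures` — **C2 ⟸ F-need ∧ Stevens I (`c₁ = ±1`) ∧ Stevens II
  (max covolume of `E₁`) ∧ E-an-152b** (no Kato fact, no Kummer law, no census law other than the index-`4` exclusion);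
* `not_three_dvd_maninConstant_of_stevensConjectures` / `maninPrimeToThreeAtNine_of_stevensConjectures` — **C3 ⟸ F-need ∧ Stevens I ∧
  Stevens II ∧ the index-`9` exclusion** (inline: `Λ₁(f) ≠ 3Λ₀(f)` for lattice-optimal data at `9 ∣ N`).

Why the index exclusions do not follow from Stevens' conjectures: in the index-`4` (resp. `9`) configuration `E₀ = E₁` with `c₀ = ±2c₁`
(resp. `±3c₁`), compatible with both conjectures and violating Manin's; they ARE implied by Manin's conjecture (E-an-68,
`index_ne_four_of_not_two_dvd_maninConstant`; `index_ne_nine_of_not_three_dvd_maninConstant`).  HONEST FRAMING: CONDITIONAL theorems; Stevens'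
conjectures are OPEN (the tree carries them as `@[conjecture]` / a plain predicate, nothing asserted); E-an-152b and the index-`9` law are OPEN
cell laws (census 0/338, resp. the `N = 9p` theorem `not_periodLatticeGamma1_eq_three_mul_of_nine_mul_prime`); BSD is not proved; Manin's
conjecture is not proved; C2/C3 OPEN.  No definitions, no named facts, no sorry.
-/

set_option autoImplicit false
-- the summit-side namespace `Summit.BirchSwinnertonDyer.BirchSwinnertonDyer.…` is the tree's (summit = sub-problem)
set_option linter.dupNamespace false

noncomputable section

open scoped Classical
open WeierstrassCurve Literature.NumberTheory.EllipticCurves Literature.NumberTheory.EllipticCurves.ModularForms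
open CongruenceSubgroup
open Summit.BirchSwinnertonDyer.Rank1Residual.ManinAdditive.ShimuraKernel
open Summit.BirchSwinnertonDyer.Rank1Residual.ManinAdditive.KatoCurve
open Summit.BirchSwinnertonDyer.Rank1Residual.ManinConstant

namespace Summit.BirchSwinnertonDyer.BirchSwinnertonDyer.Theorems.ManinLocalTwoThree

variable {W₁ W₀ : WeierstrassCurve ℚ} [W₁.IsElliptic] [W₁.IsGloballyMinimal] [W₀.IsElliptic]
  [W₀.IsGloballyMinimal] {N : ℕ} [NeZero N]

/-! ## §0 Covolume: a sub-lattice of no larger covolume is the whole lattice -/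

omit [W₁.IsGloballyMinimal] [W₀.IsGloballyMinimal] [NeZero N] in
/-- If `L₀ ≤ L₁` (period lattices in `ℂ`) and `covol L₀ ≤ covol L₁` then `L₁ ≤ L₀`: the index `covol L₀ / covol L₁ ∈ ℕ` is `1`
(`ZLattice.covolume_div_covolume_eq_relIndex'`, `AddSubgroup.relIndex_eq_one`). [folklore] -/
theorem lattice_le_of_le_of_covolume_le (L₀ L₁ : PeriodPair) (hle : L₀.lattice ≤ L₁.lattice)
    (hcov : ZLattice.covolume L₀.lattice ≤ ZLattice.covolume L₁.lattice) : L₁.lattice ≤ L₀.lattice := by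
  have hq := ZLattice.covolume_div_covolume_eq_relIndex' L₀.lattice L₁.lattice hle
  have h0 : 0 < ZLattice.covolume L₀.lattice := ZLattice.covolume_pos L₀.lattice MeasureTheory.volume
  have h1 : 0 < ZLattice.covolume L₁.lattice := ZLattice.covolume_pos L₁.lattice MeasureTheory.volume
  have hle1 : ZLattice.covolume L₀.lattice / ZLattice.covolume L₁.lattice ≤ 1 := (div_le_one h1).mpr hcov
  have hpos : 0 < ZLattice.covolume L₀.lattice / ZLattice.covolume L₁.lattice := div_pos h0 h1
  rw [hq] at hle1 hpos
  have hn : L₀.lattice.toAddSubgroup.relIndex L₁.lattice.toAddSubgroup = 1 := by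
    have h1' : (L₀.lattice.toAddSubgroup.relIndex L₁.lattice.toAddSubgroup : ℝ) ≤ 1 := hle1
    have h0' : (0 : ℝ) < L₀.lattice.toAddSubgroup.relIndex L₁.lattice.toAddSubgroup := hpos
    have a : L₀.lattice.toAddSubgroup.relIndex L₁.lattice.toAddSubgroup ≤ 1 := by exact_mod_cast h1'
    have b : 0 < L₀.lattice.toAddSubgroup.relIndex L₁.lattice.toAddSubgroup := by exact_mod_cast h0'
    omega
  intro x hx
  exact AddSubgroup.relIndex_eq_one.mp hn hx

/-! ## §1 Stevens II ∧ doubling ⟹ index `4`; Stevens II ∧ tripling ⟹ index `9` -/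

omit [W₁.IsGloballyMinimal] in
/-- **At `4 ∣ N`: if Stevens' curve has maximal Néron covolume in its class, `|c₀| = 2|c₁|` forces `Λ₁(f) = 2Λ₀(f)`.**  For the optimal
`X₁(N)`-datum `D₁` of `W₁` and a lattice-optimal `X₀(N)`-datum `D₀` of an isogenous `W₀` (globally minimal models): doubling gives
`Λ_{E₀} = 2c₁εΛ₀ ⊆ c₁Λ₁ = Λ_{E₁}` (Ling–Oesterlé `2Λ₀ ⊆ Λ₁`); maximality of `covol Λ_{E₁}` and §0 give `Λ_{E₁} = Λ_{E₀}`, whence `Λ₁ = 2Λ₀`.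
(The optimality of `D₁` and the minimality of `W₁` are not even used: any `X₁(N)`-datum of a max-covolume curve will do.)
[cite: Stevens1989, Conjecture II and Thm. 2.3 (shape: the X₁-optimal curve is the minimal curve; nothing asserted — taken as the hypothesis `IsMaxCovolumeInClass W₁`)] -/
theorem index_four_of_maxCovolume_of_natAbs_eq_two_mul (D₁ : Gamma1ParametrizationData W₁ N)
    (D₀ : ModularParametrizationData W₀ N) (hiso : IsIsogenous W₁ W₀)
    (h₀ : ∀ z ∈ D₀.L.lattice, ∃ w ∈ periodLattice D₀.f, z = D₀.c * w) (h4 : 2 ^ 2 ∣ N)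
    (hmax : IsMaxCovolumeInClass W₁) (hdouble : D₀.maninConstant.natAbs = 2 * D₁.maninConstant.natAbs) :
    ∀ z : ℂ, z ∈ periodLatticeGamma1 D₀.f ↔ ∃ w ∈ periodLattice D₀.f, z = 2 * w := by
  have hf : D₁.f = D₀.f := D₁.f_eq_of_isIsogenous D₀ hiso
  have hc₁ : (D₁.c : ℂ) ≠ 0 := by exact_mod_cast D₁.maninConstant_ne_zero
  obtain ⟨ε, hε, hcc⟩ : ∃ ε : ℂ, (ε = 1 ∨ ε = -1) ∧ (D₀.c : ℂ) = ε * (2 * D₁.c) := by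
    have h : D₀.maninConstant.natAbs = (2 * D₁.maninConstant).natAbs := by rw [hdouble, Int.natAbs_mul]; rfl
    rcases Int.natAbs_eq_natAbs_iff.mp h with h' | h'
    · exact ⟨1, Or.inl rfl, by rw [one_mul]; exact_mod_cast h'⟩
    · exact ⟨-1, Or.inr rfl, by rw [neg_one_mul]; exact_mod_cast h'⟩
  have hεmem : ∀ (S : AddSubgroup ℂ) (y : ℂ), y ∈ S → ε * y ∈ S := by
    intro S y hy; rcases hε with rfl | rfl
    · rwa [one_mul]
    · rw [neg_one_mul]; exact neg_mem hy
  have h2Λ : ∀ v ∈ periodLattice D₀.f, (2 : ℂ) * v ∈ periodLatticeGamma1 D₀.f := fun v hv ↦ by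
    have h := pMulLatticeLeGamma1OfTracelessPrime_holds N D₀.f D₀.isNewformOf.1 2 Nat.prime_two
      ((dvd_pow_self 2 two_ne_zero).trans h4) (D₀.isNewformOf.1.cuspCoeff_eq_zero_of_sq_dvd Nat.prime_two h4) v hv
    exact_mod_cast h
  have hle : D₀.L.lattice ≤ D₁.L.lattice := by
    intro z hz
    obtain ⟨v, hv, rfl⟩ := h₀ z hz
    have e : (D₀.c : ℂ) * v = (D₁.c : ℂ) * (ε * (2 * v)) := by rw [hcc]; ring
    rw [e]
    exact D₁.smul_periodLatticeGamma1_le _ (hεmem _ _ (by rw [hf]; exact h2Λ v hv))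
  have hcov := hmax W₀ D₁.L D₀.L inferInstance inferInstance hiso D₁.isNeronLattice D₀.isNeronLattice
  have hge : D₁.L.lattice ≤ D₀.L.lattice := lattice_le_of_le_of_covolume_le D₀.L D₁.L hle hcov
  intro z
  constructor
  · intro hz
    have hz' : (D₁.c : ℂ) * z ∈ D₀.L.lattice := hge (D₁.smul_periodLatticeGamma1_le z (hf ▸ hz))
    obtain ⟨v, hv, hv'⟩ := h₀ _ hz'
    refine ⟨ε * v, hεmem _ _ hv, ?_⟩
    have h : (D₁.c : ℂ) * z = (D₁.c : ℂ) * (2 * (ε * v)) := by rw [hv', hcc]; ring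
    exact mul_left_cancel₀ hc₁ h
  · rintro ⟨v, hv, rfl⟩
    exact h2Λ v hv

omit [W₁.IsGloballyMinimal] in
/-- **At `9 ∣ N`: maximal covolume of Stevens' curve and `|c₀| = 3|c₁|` force `Λ₁(f) = 3Λ₀(f)`.** (Same argument, `3Λ₀ ⊆ Λ₁`.)
[cite: Stevens1989, Conjecture II and Thm. 2.3] -/
theorem index_nine_of_maxCovolume_of_natAbs_eq_three_mul (D₁ : Gamma1ParametrizationData W₁ N)
    (D₀ : ModularParametrizationData W₀ N) (hiso : IsIsogenous W₁ W₀)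
    (h₀ : ∀ z ∈ D₀.L.lattice, ∃ w ∈ periodLattice D₀.f, z = D₀.c * w) (h9 : 3 ^ 2 ∣ N)
    (hmax : IsMaxCovolumeInClass W₁) (htri : D₀.maninConstant.natAbs = 3 * D₁.maninConstant.natAbs) :
    ∀ z : ℂ, z ∈ periodLatticeGamma1 D₀.f ↔ ∃ w ∈ periodLattice D₀.f, z = 3 * w := by
  have hf : D₁.f = D₀.f := D₁.f_eq_of_isIsogenous D₀ hiso
  have hc₁ : (D₁.c : ℂ) ≠ 0 := by exact_mod_cast D₁.maninConstant_ne_zero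
  obtain ⟨ε, hε, hcc⟩ : ∃ ε : ℂ, (ε = 1 ∨ ε = -1) ∧ (D₀.c : ℂ) = ε * (3 * D₁.c) := by
    have h : D₀.maninConstant.natAbs = (3 * D₁.maninConstant).natAbs := by rw [htri, Int.natAbs_mul]; rfl
    rcases Int.natAbs_eq_natAbs_iff.mp h with h' | h'
    · exact ⟨1, Or.inl rfl, by rw [one_mul]; exact_mod_cast h'⟩
    · exact ⟨-1, Or.inr rfl, by rw [neg_one_mul]; exact_mod_cast h'⟩
  have hεmem : ∀ (S : AddSubgroup ℂ) (y : ℂ), y ∈ S → ε * y ∈ S := by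
    intro S y hy; rcases hε with rfl | rfl
    · rwa [one_mul]
    · rw [neg_one_mul]; exact neg_mem hy
  have h3Λ : ∀ v ∈ periodLattice D₀.f, (3 : ℂ) * v ∈ periodLatticeGamma1 D₀.f := fun v hv ↦ by
    have h := pMulLatticeLeGamma1OfTracelessPrime_holds N D₀.f D₀.isNewformOf.1 3 Nat.prime_three
      ((dvd_pow_self 3 two_ne_zero).trans h9) (D₀.isNewformOf.1.cuspCoeff_eq_zero_of_sq_dvd Nat.prime_three h9) v hv
    exact_mod_cast h
  have hle : D₀.L.lattice ≤ D₁.L.lattice := by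
    intro z hz
    obtain ⟨v, hv, rfl⟩ := h₀ z hz
    have e : (D₀.c : ℂ) * v = (D₁.c : ℂ) * (ε * (3 * v)) := by rw [hcc]; ring
    rw [e]
    exact D₁.smul_periodLatticeGamma1_le _ (hεmem _ _ (by rw [hf]; exact h3Λ v hv))
  have hcov := hmax W₀ D₁.L D₀.L inferInstance inferInstance hiso D₁.isNeronLattice D₀.isNeronLattice
  have hge : D₁.L.lattice ≤ D₀.L.lattice := lattice_le_of_le_of_covolume_le D₀.L D₁.L hle hcov
  intro z
  constructor
  · intro hz
    have hz' : (D₁.c : ℂ) * z ∈ D₀.L.lattice := hge (D₁.smul_periodLatticeGamma1_le z (hf ▸ hz))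
    obtain ⟨v, hv, hv'⟩ := h₀ _ hz'
    refine ⟨ε * v, hεmem _ _ hv, ?_⟩
    have h : (D₁.c : ℂ) * z = (D₁.c : ℂ) * (3 * (ε * v)) := by rw [hv', hcc]; ring
    exact mul_left_cancel₀ hc₁ h
  · rintro ⟨v, hv, rfl⟩
    exact h3Λ v hv

/-! ## §2 The transfer and C2 from Stevens' conjectures -/

/-- **At `4 ∣ N`: Stevens II for `E₁` and the index-`4` exclusion give `|c₀| = |c₁|`** (ledger dichotomy + §1). -/
theorem natAbs_maninConstant₀_eq_of_maxCovolume_of_index_ne_four (D₁ : Gamma1ParametrizationData W₁ N)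
    (D₀ : ModularParametrizationData W₀ N) (hiso : IsIsogenous W₁ W₀) (h₁ : D₁.IsOptimal)
    (h₀ : ∀ z ∈ D₀.L.lattice, ∃ w ∈ periodLattice D₀.f, z = D₀.c * w) (h4 : 2 ^ 2 ∣ N)
    (hmax : IsMaxCovolumeInClass W₁)
    (hne4 : ¬ (∀ z : ℂ, z ∈ periodLatticeGamma1 D₀.f ↔ ∃ w ∈ periodLattice D₀.f, z = 2 * w)) :
    D₀.maninConstant.natAbs = D₁.maninConstant.natAbs := by
  rcases natAbs_maninConstant₀_eq_or_eq_two_mul_of_four_dvd_level D₁ D₀ hiso h₁ h₀ h4 with h | h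
  · exact h
  · exact absurd (index_four_of_maxCovolume_of_natAbs_eq_two_mul D₁ D₀ hiso h₀ h4 hmax h) hne4

omit [W₁.IsElliptic] [W₁.IsGloballyMinimal] [W₀.IsElliptic] [W₀.IsGloballyMinimal] [NeZero N] in
/-- **E-an-151 `GammaOneTransferAtFour` ⟸ Stevens II (maximal covolume of every Stevens curve at `4 ∣ N`) ∧ E-an-152b `ShimuraIndexNeFourAtFour`.**
[cite: Stevens1989, Conjecture II] -/
theorem gammaOneTransferAtFour_of_maxCovolume
    (hSt2 : ∀ (W₁ : WeierstrassCurve ℚ) [W₁.IsElliptic] [W₁.IsGloballyMinimal] {N : ℕ} [NeZero N]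
      (D₁ : Gamma1ParametrizationData W₁ N), D₁.IsOptimal → 2 ^ 2 ∣ N → IsMaxCovolumeInClass W₁)
    (h152b : ShimuraIndexNeFourAtFour) : GammaOneTransferAtFour := by
  intro W₁ W₀ _ _ _ _ N _ D₁ D₀ hiso h₁ h₀ h4
  exact natAbs_maninConstant₀_eq_of_maxCovolume_of_index_ne_four D₁ D₀ hiso h₁ h₀ h4 (hSt2 W₁ D₁ h₁ h4)
    (h152b W₀ D₀ h₀ h4)

omit [W₁.IsElliptic] [W₁.IsGloballyMinimal] [W₀.IsElliptic] [W₀.IsGloballyMinimal] [NeZero N] in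
/-- **Stevens I `StevensConstantOne` ⟹ C2¹-class `GammaOneOddOfClassAtFour`** (`|c₁| = 1` is odd). [cite: Stevens1989, Conjectures I/III (c₁ = ±1; nothing asserted — hypothesis)] -/
theorem gammaOneOddOfClassAtFour_of_stevensConstantOne (hSt1 : StevensConstantOne) : GammaOneOddOfClassAtFour := by
  intro W₁ W₀ _ _ _ _ N _ D₁ D₀ _hiso h₁ _h₀ _h4 h2
  have h := hSt1 W₁ D₁ h₁
  have h2' : (2 : ℤ) ∣ |D₁.maninConstant| := (dvd_abs _ _).mpr h2
  rw [h] at h2'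
  norm_num at h2'

omit [W₁.IsElliptic] [W₁.IsGloballyMinimal] [W₀.IsElliptic] [W₀.IsGloballyMinimal] [NeZero N] in
/-- **C2-body ⟸ F-need ∧ Stevens I ∧ Stevens II ∧ E-an-152b.**  Manin's conjecture at `2` (oddness of `c₀` for every lattice-optimal
`X₀(N)`-datum with `4 ∣ N`) follows from Stevens' two 1989 conjectures, the index-`4` exclusion, and the existence of the Stevens datum
(`ShimuraKernel.body_of_transfer_of_gammaOneOdd`).  CONDITIONAL; all four inputs are OPEN / statement-only.
[cite: Stevens1989, Conjectures I–III] [cite: CesnaviciusNeururerSaha2023, Lemma 6.5] -/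
theorem maninOddAtFourBody_of_stevensConjectures (hex : exists_optimal_gamma1ParametrizationData)
    (hSt1 : StevensConstantOne)
    (hSt2 : ∀ (W₁ : WeierstrassCurve ℚ) [W₁.IsElliptic] [W₁.IsGloballyMinimal] {N : ℕ} [NeZero N]
      (D₁ : Gamma1ParametrizationData W₁ N), D₁.IsOptimal → 2 ^ 2 ∣ N → IsMaxCovolumeInClass W₁)
    (h152b : ShimuraIndexNeFourAtFour) : ManinOddAtFourBody :=
  body_of_transfer_of_gammaOneOdd hex (gammaOneTransferAtFour_of_maxCovolume hSt2 h152b)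
    (gammaOneOddOfClassAtFour_of_stevensConstantOne hSt1)

omit [W₁.IsElliptic] [W₁.IsGloballyMinimal] [W₀.IsElliptic] [W₀.IsGloballyMinimal] [NeZero N] in
/-- **The route declaration C2 `ManinOddAtFour` ⟸ F-need ∧ Stevens I ∧ Stevens II ∧ E-an-152b** (its four printed-fact hypotheses are
not even used).  CONDITIONAL; BSD is not proved by this; C2 OPEN. [cite: Stevens1989, Conjectures I–III] -/
theorem maninOddAtFour_of_stevensConjectures (hex : exists_optimal_gamma1ParametrizationData)
    (hSt1 : StevensConstantOne)
    (hSt2 : ∀ (W₁ : WeierstrassCurve ℚ) [W₁.IsElliptic] [W₁.IsGloballyMinimal] {N : ℕ} [NeZero N]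
      (D₁ : Gamma1ParametrizationData W₁ N), D₁.IsOptimal → 2 ^ 2 ∣ N → IsMaxCovolumeInClass W₁)
    (h152b : ShimuraIndexNeFourAtFour) :
    Summit.BirchSwinnertonDyer.BirchSwinnertonDyer.Theses.ManinLocalTwoThree.ManinOddAtFour :=
  fun _ _ _ _ W _ _ _ _ D hL h4 ↦ maninOddAtFourBody_of_stevensConjectures hex hSt1 hSt2 h152b W D hL h4

/-! ## §3 C3 from Stevens' conjectures and the index-`9` exclusion -/

/-- **At `9 ∣ N`: Stevens I ∧ Stevens II for the Stevens datum ∧ `Λ₁(f) ≠ 3Λ₀(f)` ⟹ `3 ∤ c₀`.**  Tripling is excluded by §1, so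
`|c₀| = |c₁| = 1`. [cite: Stevens1989, Conjectures I–III] -/
theorem not_three_dvd_maninConstant_of_stevensConjectures (D₁ : Gamma1ParametrizationData W₁ N)
    (D₀ : ModularParametrizationData W₀ N) (hiso : IsIsogenous W₁ W₀) (h₁ : D₁.IsOptimal)
    (h₀ : ∀ z ∈ D₀.L.lattice, ∃ w ∈ periodLattice D₀.f, z = D₀.c * w) (h9 : 3 ^ 2 ∣ N)
    (hSt1 : StevensConstantOne) (hmax : IsMaxCovolumeInClass W₁)
    (hne9 : ¬ (∀ z : ℂ, z ∈ periodLatticeGamma1 D₀.f ↔ ∃ w ∈ periodLattice D₀.f, z = 3 * w)) :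
    ¬ (3 : ℤ) ∣ D₀.maninConstant := by
  have heq : D₀.maninConstant.natAbs = D₁.maninConstant.natAbs := by
    rcases natAbs_maninConstant₀_eq_or_eq_three_mul_of_nine_dvd_level D₁ D₀ hiso h₁ h₀ h9 with h | h
    · exact h
    · exact absurd (index_nine_of_maxCovolume_of_natAbs_eq_three_mul D₁ D₀ hiso h₀ h9 hmax h) hne9
  have h1 : |D₁.maninConstant| = 1 := hSt1 W₁ D₁ h₁
  have h1' : D₁.maninConstant.natAbs = 1 := by
    have := Int.abs_eq_natAbs D₁.maninConstant
    rw [h1] at this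
    exact_mod_cast this.symm
  intro h3
  have h3' : (3 : ℤ).natAbs ∣ D₀.maninConstant.natAbs := Int.natAbs_dvd_natAbs.mpr h3
  rw [heq, h1'] at h3'
  norm_num at h3'

omit [W₁.IsElliptic] [W₁.IsGloballyMinimal] [W₀.IsElliptic] [W₀.IsGloballyMinimal] [NeZero N] in
/-- **The route declaration C3 `ManinPrimeToThreeAtNine` ⟸ F-need ∧ Stevens I ∧ Stevens II ∧ the index-`9` exclusion** (inline law: no
lattice-optimal datum at `9 ∣ N` has `Λ₁(f) = 3Λ₀(f)`; it is a theorem at `N = 9p`, `p ≡ 2 (mod 3)`).  CONDITIONAL; BSD is not proved by this;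
C3 OPEN. [cite: Stevens1989, Conjectures I–III] -/
theorem maninPrimeToThreeAtNine_of_stevensConjectures (hex : exists_optimal_gamma1ParametrizationData)
    (hSt1 : StevensConstantOne)
    (hSt2 : ∀ (W₁ : WeierstrassCurve ℚ) [W₁.IsElliptic] [W₁.IsGloballyMinimal] {N : ℕ} [NeZero N]
      (D₁ : Gamma1ParametrizationData W₁ N), D₁.IsOptimal → 3 ^ 2 ∣ N → IsMaxCovolumeInClass W₁)
    (hne9 : ∀ (W₀ : WeierstrassCurve ℚ) [W₀.IsElliptic] [W₀.IsGloballyMinimal] {N : ℕ} [NeZero N]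
      (D₀ : ModularParametrizationData W₀ N),
      (∀ z ∈ D₀.L.lattice, ∃ w ∈ periodLattice D₀.f, z = D₀.c * w) → 3 ^ 2 ∣ N →
      ¬ (∀ z : ℂ, z ∈ periodLatticeGamma1 D₀.f ↔ ∃ w ∈ periodLattice D₀.f, z = 3 * w)) :
    Summit.BirchSwinnertonDyer.BirchSwinnertonDyer.Theses.ManinLocalTwoThree.ManinPrimeToThreeAtNine := by
  intro _ _ _ _ W₀ _ _ N _ D₀ h₀ h9
  obtain ⟨W₁, _, _, D₁, hiso, h₁⟩ := hex W₀ D₀ h₀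
  exact not_three_dvd_maninConstant_of_stevensConjectures D₁ D₀ hiso h₁ h₀ h9 hSt1 (hSt2 W₁ D₁ h₁ h9) (hne9 W₀ D₀ h₀ h9)

end Summit.BirchSwinnertonDyer.BirchSwinnertonDyer.Theorems.ManinLocalTwoThree

end
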